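import Literature.Geometry.MetricEmbeddings.HeisenbergKoranyi
import HarnessLib

/-!
# Vertical and horizontal lines in `(ℍ, d_K)`

Family `pnp`, layer `Literature/Geometry/MetricEmbeddings`; sibling proofs file (theorems only) of
`HeisenbergKoranyi.lean`. Source: J. Cheeger, B. Kleiner, A. Naor, arXiv:0910.2026 = Acta Math. 207
(2011), §1.1 Thm. 1.1 ("at least half of the points `(x₁,x₂) ∈ B_r(x) × B_r(x)` which lie on the
same coset of the center satisfy `‖f(x₁)−f(x₂)‖ ≤ d^ℍ(x₁,x₂)/(log(1/ε))^δ`" — CENTRAL collapse) and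
§2 (arXiv pp. 7–8: "A subset `E ⊂ ℍ` is called monotone if for every horizontal line `L`, up to a
set of measure zero, `E ∩ L` is a sub-ray of the line. If we view `ℍ = ℝ³`, the horizontal lines
are a certain codimension `1` subset of all the lines"). The two distinguished families of lines of
the proof of [CKN Thm. 1.1], in the model `HeisK` (law `(x,y,z)(x',y',z') = (x+x', y+y', z+z'+xy')`,
Cygan–Korányi metric `d_K`):

* the **cosets of the centre** are the vertical lines `{(x, y, ·)}` (`mul_center`), along which
  `d_K` is the `½`-snowflake of the parameter: `d_K(p, p·(0,0,c)) = 2√|c|` (`dist_mul_center`);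
* the **horizontal lines** `t ↦ p·(ta, tb, ab t²/2)` (`a² + b² = 1`; left translates of the
  horizontal one-parameter subgroups `horizontal_mul`, which are dilation orbits
  `horizontal_eq_dilate`) are geodesics, isometric copies of `ℝ`: `d_K(p·γ(s), p·γ(t)) = |s − t|`
  (`dist_horizontal`).

NOT here: the space `lines(ℍ)` of horizontal lines with its invariant measure `𝒩`, monotone sets,
the kinematic formula ([CKN] §§2, 6).

## References

* [CheegerKleinerNaor2011] J. Cheeger, B. Kleiner, A. Naor, Acta Math. 207 (2011) 291–373, §1.1
  Thm. 1.1 and §2 (arXiv:0910.2026 pp. 4, 7–8).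
* [Cygan1981] J. Cygan, Proc. AMS 83 (1981) 69–70.
-/

noncomputable section

namespace Literature.Geometry.MetricEmbeddings

namespace HeisK

/-! ### The centre: vertical lines are `½`-snowflaked -/

/-- Right multiplication by a central element moves along the vertical line:
`p · (0,0,c) = (x, y, z + c)`; the cosets of the centre are the vertical lines `{(x, y, ·)}`.
[cite: CheegerKleinerNaor2011, §1.1] -/
theorem mul_center (p : HeisK) (c : ℝ) : p * mk 0 0 c = mk p.x p.y (p.z + c) := by
  ext <;> simp

/-- The gauge of a central element: `‖(0,0,c)‖_K = 2√|c|`. [cite: Cygan1981, p. 69] -/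
theorem gauge_center (c : ℝ) : gauge (mk 0 0 c) = 2 * Real.sqrt |c| := by
  have hq : quartic (mk 0 0 c) = (4 * |c|) ^ 2 := by
    simp only [quartic, mk_x, mk_y, mk_z]
    rw [mul_pow, sq_abs]
    ring
  rw [gauge, hq, Real.sqrt_sq (by positivity), Real.sqrt_mul' _ (abs_nonneg c),
    show (4 : ℝ) = 2 ^ 2 by norm_num, Real.sqrt_sq (by norm_num)]

/-- **Vertical lines are `½`-snowflaked**: `d_K(p, p·(0,0,c)) = 2√|c|` — two points on the same
coset of the centre at vertical parameter distance `|c|` are at distance `2√|c|` (the pairs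
`(x₁, x₂)` "which lie on the same coset of the center" of [CKN Thm. 1.1]).
[cite: CheegerKleinerNaor2011, §1.1 Thm. 1.1] -/
theorem dist_mul_center (p : HeisK) (c : ℝ) : dist p (p * mk 0 0 c) = 2 * Real.sqrt |c| := by
  rw [dist_eq, inv_mul_cancel_left, gauge_center]

/-- Central translates commute with everything, so `d_K(p·(0,0,c), q·(0,0,c)) = d_K(p, q)`:
right multiplication by a central element is an isometry. [cite: CheegerKleinerNaor2011, §1.1] -/
theorem dist_mul_center_right (p q : HeisK) (c : ℝ) :
    dist (p * mk 0 0 c) (q * mk 0 0 c) = dist p q := by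
  rw [← center_mul_comm c p, ← center_mul_comm c q, dist_mul_left]

/-! ### Horizontal lines are geodesics -/

/-- The horizontal one-parameter subgroups: for a horizontal direction `(a, b)`,
`t ↦ (ta, tb, ab t²/2)` is a group homomorphism `ℝ → ℍ`.
[cite: CheegerKleinerNaor2011, §2 (arXiv p. 8)] -/
theorem horizontal_mul (a b s t : ℝ) :
    mk (s * a) (s * b) (a * b * s ^ 2 / 2) * mk (t * a) (t * b) (a * b * t ^ 2 / 2) =
      mk ((s + t) * a) ((s + t) * b) (a * b * (s + t) ^ 2 / 2) := by
  ext <;> simp <;> ring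

/-- [cite: CheegerKleinerNaor2011, §2 (arXiv p. 8)] -/
theorem horizontal_zero (a b : ℝ) : mk (0 * a) (0 * b) (a * b * 0 ^ 2 / 2) = 1 := by
  ext <;> simp

/-- [cite: CheegerKleinerNaor2011, §2 (arXiv p. 8)] -/
theorem horizontal_inv (a b t : ℝ) :
    (mk (t * a) (t * b) (a * b * t ^ 2 / 2))⁻¹ = mk (-t * a) (-t * b) (a * b * (-t) ^ 2 / 2) := by
  rw [inv_eq_iff_mul_eq_one, horizontal_mul]
  convert horizontal_zero a b using 2 <;> ring

/-- Horizontal subgroups are dilation orbits: `(ta, tb, ab t²/2) = δ_t (a, b, ab/2)`.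
[cite: CheegerKleinerNaor2011, §1.1] -/
theorem horizontal_eq_dilate (a b t : ℝ) :
    mk (t * a) (t * b) (a * b * t ^ 2 / 2) = dilate t (mk a b (a * b / 2)) := by
  ext <;> simp only [mk_x, mk_y, mk_z, dilate_x, dilate_y, dilate_z]
  ring

/-- The gauge along a unit horizontal direction: `‖(ta, tb, ab t²/2)‖_K = |t|` when `a² + b² = 1`.
[cite: Cygan1981, p. 69] -/
theorem gauge_horizontal {a b : ℝ} (hab : a ^ 2 + b ^ 2 = 1) (t : ℝ) :
    gauge (mk (t * a) (t * b) (a * b * t ^ 2 / 2)) = |t| := by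
  have h1 : gauge (mk a b (a * b / 2)) = 1 := by
    have hq : quartic (mk a b (a * b / 2)) = 1 := by
      simp only [quartic, mk_x, mk_y, mk_z, hab]
      ring
    simp [gauge, hq]
  rw [horizontal_eq_dilate, gauge_dilate, h1, mul_one]

/-- **Horizontal lines are geodesics**: for every `p ∈ ℍ` and unit horizontal direction `(a,b)`,
the horizontal line `t ↦ p · (ta, tb, ab t²/2)` is an isometric copy of `ℝ` in `(ℍ, d_K)`:
`d_K(p·γ(s), p·γ(t)) = |s − t|` (in contrast with the vertical lines, `dist_mul_center`).
[cite: CheegerKleinerNaor2011, §2 (arXiv p. 8)] -/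
theorem dist_horizontal (p : HeisK) {a b : ℝ} (hab : a ^ 2 + b ^ 2 = 1) (s t : ℝ) :
    dist (p * mk (s * a) (s * b) (a * b * s ^ 2 / 2)) (p * mk (t * a) (t * b) (a * b * t ^ 2 / 2)) =
      |s - t| := by
  rw [dist_mul_left, dist_eq, horizontal_inv, horizontal_mul, gauge_horizontal hab, abs_sub_comm]
  congr 1
  ring

/-- Dilations map horizontal lines through `1` to themselves, reparametrised:
`δ_r (ta, tb, ab t²/2) = ((rt)a, (rt)b, ab (rt)²/2)`. [cite: CheegerKleinerNaor2011, §1.1] -/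
theorem dilate_horizontal (r a b t : ℝ) :
    dilate r (mk (t * a) (t * b) (a * b * t ^ 2 / 2)) =
      mk ((r * t) * a) ((r * t) * b) (a * b * (r * t) ^ 2 / 2) := by
  ext <;> simp <;> ring

end HeisK

end Literature.Geometry.MetricEmbeddings

end
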